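import Literature.AnabelianGeometry.EtaleTheta.ContH1Separated
import HarnessLib

/-!
# Continuous `H¹` with profinite coefficients: a COMPACTLY PARAMETRISED family of classes is congruence-closed
# (support file for [EtTh] §1, Remark 1.6.4)

Neukirch–Schmidt–Wingberg, *Cohomology of Number Fields*, I §2 / II §7 (continuous cochains with profinite
coefficients; `H¹` as crossed homomorphisms modulo principal ones) [cite: NeukirchSchmidtWingberg2008, I §2 and II §7];
used for Mochizuki, *The étale theta function …*, Publ. RIMS **45** (2009) [EtTh], Remark 1.6.4 p. 252 — the set of
classes "`O^×_K̈ · (η̈^Θ)^∧ ∈ H¹(Π_{Ÿ^∧}, Δ_Θ)`" [cite: MochizukiEtTh2009, Rmk 1.6.4 p.252]: in the cell's topology-free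
route to the `Ẑ ∋ a` form of the action formula (abc-iut VNEXT «RMK164-(c2)-ZHAT», residual (r1) of the cone row
EtTh:Rmk1.6.4, steps (Z1)–(Z5)) the class `D(σ̂)` attached to a profinite `σ̂ ∈ Π_X` is shown to be congruent, modulo
EVERY open normal subgroup `N` of the coefficient ambient group, to SOME unit class `u_N` (a different one for each
`N`, coming from a different tempered approximation `σ_N` of `σ̂`); to conclude that `D(σ̂)` IS a unit class one needs
the unit classes to be CONGRUENCE-CLOSED («needed for ONE `u` serving every `N`», abc-iut-f-128 gen 8, 2026-08-27).
This file proves that closedness for any family of classes parametrised by a COMPACT space with pointwise-continuous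
representing cocycles — e.g. the Kummer classes of a compact group of units given by a continuous Kummer cocycle.

PROOF-ONLY (abc-iut cell, prover abc-iut-f-142 gen 9; generic `ContH1` API over abc-iut-L2-t5's carrier `ContH1` and
abc-iut-f-128's `ContH1Separated`; no definitions, no instances, no `Prop`-valued facts; Mathlib + those two files only).  For the tree's `ContH1 φ A H` with
PROFINITE ambient coefficient group `G′` (compact, Hausdorff, totally disconnected) and `A` closed, and a family
`u : K → contCocycles φ A H` with `K` COMPACT and `k ↦ (u k)(h)` continuous for each `h`:
* `ContH1.exists_mul_inv_mem_contCoboundaries_of_forall_congr_family` — representative level: if for every open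
  normal `N ⊴ G′` there are `k ∈ K` and `a ∈ A` with `f(h) · (u k)(h)⁻¹ · (∂a)(h)⁻¹ ∈ N` for all `h`, then
  `f · (u k)⁻¹` is a coboundary for SOME `k`.  Proof: the sets `S_N ⊆ K × A` of such pairs `(k, a)` are closed,
  non-empty and directed in the COMPACT `K × A` (finite-intersection property), and at a common point `(k, a)` the
  element `f(h)·(u k)(h)⁻¹·(∂a)(h)⁻¹` lies in every `N`, hence is `1`;
* `ContH1.exists_eq_mk_of_forall_exists_rep_congr_family` — **class level, in the representative-congruence
  currency of `ContH1Separated`** (`∃ f g` representatives with `f(h)·g(h)⁻¹ ∈ N`): a class `x` congruent modulo every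
  open normal `N` to SOME member `[u k_N]` of the family EQUALS some member `[u k]`;
* `ContH1.mem_range_of_forall_exists_rep_congr_family` — the same as `x ∈ Set.range (k ↦ [u k])`
  ("`⋂_N (U · K_N) = U`" for `U` the family's set of classes and `K_N` the classes with a representative valued in `N`);
* `ContH1.exists_eq_mk_of_forall_exists_rep_congr_family₂` — the jointly-continuous case `(k, h) ↦ (u k)(h)`.
The case `K = Unit`, `u = 1` is `ContH1Separated`'s `mk_eq_one_of_forall_congr` (abc-iut-f-128).
§2 (no root systems, no cocycle family — the shape of a Kummer map on a compact unit group):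
* `ContH1.exists_eq_of_forall_exists_rep_congr_range` — for ANY homomorphism `κ : M → ContH1 φ A H` from a COMPACT
  topological group `M` such that every open normal `N ⊴ G′` admits an open subgroup `W ≤ M` with `κ(w) ≡ 1 (mod N)`
  for `w ∈ W`, the range of `κ` is congruence-closed (the sets `{m | x ≡ κ(m) mod N}` are `W`-saturated, hence
  clopen; finite-intersection property in `M`; `ContH1Separated.eq_of_forall_exists_rep_congr` concludes);
* `ContH1.exists_eq_of_forall_exists_rep_congr_range_of_pow` — the hypothesis on `κ` holds for every `κ` as soon as
  for each `n ≥ 1` the `n`-th powers of `M` contain an open subgroup (e.g. `O^×_K`, `K/ℚ_p` finite: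
  `1 + 𝔪^k ⊆ (O^×_K)ⁿ` for `k ≫ 0`), since `κ(vⁿ) = κ(v)ⁿ ≡ 1 (mod N)` once `Aⁿ ⊆ N`.
Nothing here bears on [IUTchIII] Cor. 3.12; the [EtTh] application is not made here; typed ≠ proved.
-/

noncomputable section

namespace Literature.AnabelianGeometry.EtaleTheta

open scoped IsMulCommutative
open Topology

namespace ContH1

variable {G G' : Type*} [Group G] [TopologicalSpace G]
  [Group G'] [TopologicalSpace G'] [IsTopologicalGroup G']
  {φ : G →* G'} {A : Subgroup G'} [A.Normal] [IsMulCommutative A] {H : Subgroup G}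

/-- An element of a profinite group lying in every open normal subgroup is trivial. [folklore] -/
private theorem eq_one_of_forall_mem_openNormal' [CompactSpace G'] [T2Space G'] [TotallyDisconnectedSpace G']
    (g : G') (hg : ∀ N : OpenNormalSubgroup G', g ∈ N.toSubgroup) : g = 1 := by
  by_contra hne
  obtain ⟨N, hN⟩ := ProfiniteGrp.exist_openNormalSubgroup_sub_open_nhds_of_one
    (isOpen_compl_singleton (x := g)) (show (1 : G') ∈ ({g}ᶜ : Set G') from fun h1 => hne h1.symm)
  exact hN (hg N) rfl

omit [TopologicalSpace G] [IsMulCommutative A] in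
/-- Continuity of the coboundary of `a` at a fixed place `h`: `a ↦ φ(h) a φ(h)⁻¹ · a⁻¹` is continuous `A → G′`.
[folklore] -/
private theorem continuous_coboundary_apply' (h : H) :
    Continuous fun a : A => (((MulAut.conjNormal (φ (h : G)) a * a⁻¹ : A)) : G') := by
  have : (fun a : A => (((MulAut.conjNormal (φ (h : G)) a * a⁻¹ : A)) : G')) =
      fun a : A => φ (h : G) * (a : G') * (φ (h : G))⁻¹ * ((a : G'))⁻¹ := by
    funext a
    simp [MulAut.conjNormal_apply]
  rw [this]
  fun_prop

/-- Change of representative: two cocycles with the same class differ by a coboundary, pointwise. [folklore] -/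
private theorem exists_coboundary_of_mk_eq'' (f f₀ : contCocycles φ A H)
    (hf : (QuotientGroup.mk f : ContH1 φ A H) = QuotientGroup.mk f₀) :
    ∃ b : A, ∀ h : H, f₀.1 h = f.1 h * (MulAut.conjNormal (φ (h : G)) b * b⁻¹) := by
  have hmem : f⁻¹ * f₀ ∈ (contCoboundaries φ A H).subgroupOf (contCocycles φ A H) :=
    (QuotientGroup.eq (s := (contCoboundaries φ A H).subgroupOf (contCocycles φ A H))).mp hf
  obtain ⟨b, hb⟩ := (mem_contCoboundaries_iff _).mp (Subgroup.mem_subgroupOf.mp hmem)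
  refine ⟨b, fun h => ?_⟩
  have hbh := congrFun hb h
  have hval : (((f⁻¹ * f₀ : contCocycles φ A H) : H → A) h) = (f.1 h)⁻¹ * f₀.1 h := by
    simp only [Subgroup.coe_mul, Subgroup.coe_inv, Pi.mul_apply, Pi.inv_apply]
  rw [hval] at hbh
  rw [← hbh, mul_inv_cancel_left]

omit [TopologicalSpace G] in
/-- **A compactly parametrised family of maps is congruence-closed up to coboundaries** (representative level;
profinite ambient coefficients, `A` closed).  For `f : H → A` and a family `u : K → (H → A)` with `K` COMPACT and
`k ↦ u k h` continuous for each `h` (no continuity in `h`, no cocycle condition needed): if for every open normal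
`N ⊴ G′` there are `k ∈ K`, `a ∈ A` with `f(h) · (u k h)⁻¹ · (φ(h) a φ(h)⁻¹ a⁻¹)⁻¹ ∈ N` for all `h`, then for SOME
`k ∈ K` the map `f · (u k)⁻¹` is the coboundary of some `a` — by compactness of `K × A` (finite-intersection property of
the closed sets of such `(k, a)`) and `⋂ N = 1`. [cite: NeukirchSchmidtWingberg2008, I §2 and II §7] -/
theorem exists_mul_inv_mem_contCoboundaries_of_forall_congr_family [CompactSpace G'] [T2Space G']
    [TotallyDisconnectedSpace G'] (hA : IsClosed (A : Set G')) {K : Type*} [TopologicalSpace K] [CompactSpace K]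
    (u : K → H → A) (hu : ∀ h : H, Continuous fun k : K => ((u k h : A) : G')) (f : H → A)
    (hf : ∀ N : OpenNormalSubgroup G', ∃ k : K, ∃ a : A, ∀ h : H,
      ((f h : A) : G') * (((u k h : A) : G'))⁻¹ *
        ((((MulAut.conjNormal (φ (h : G)) a * a⁻¹ : A)) : G'))⁻¹ ∈ N.toSubgroup) :
    ∃ k : K, f * (u k)⁻¹ ∈ contCoboundaries φ A H := by
  classical
  haveI : CompactSpace A := isCompact_iff_compactSpace.mp hA.isCompact
  haveI : Nonempty (OpenNormalSubgroup G') :=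
    ⟨{ toOpenSubgroup := ⊤, isNormal' := by
        rw [OpenSubgroup.toSubgroup_top]
        infer_instance }⟩
  -- the closed, non-empty, directed family `S_N ⊆ K × A`
  let e : H → K × A → G' := fun h q =>
    ((f h : A) : G') * (((u q.1 h : A) : G'))⁻¹ *
      ((((MulAut.conjNormal (φ (h : G)) q.2 * q.2⁻¹ : A)) : G'))⁻¹
  have he : ∀ h : H, Continuous (e h) := by
    intro h
    refine (continuous_const.mul ((hu h).comp continuous_fst).inv).mul ?_
    exact ((continuous_coboundary_apply' (φ := φ) h).comp continuous_snd).inv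
  let S : OpenNormalSubgroup G' → Set (K × A) := fun N => {q : K × A | ∀ h : H, e h q ∈ N.toSubgroup}
  have hScl : ∀ N, IsClosed (S N) := by
    intro N
    have : S N = ⋂ h : H, (e h) ⁻¹' ((N.toSubgroup : Subgroup G') : Set G') := by
      ext q
      simp only [Set.mem_setOf_eq, Set.mem_iInter, Set.mem_preimage, SetLike.mem_coe, S]
    rw [this]
    exact isClosed_iInter fun h => N.toOpenSubgroup.isClosed.preimage (he h)
  have hSne : ∀ N, (S N).Nonempty := by
    intro N
    obtain ⟨k, a, hka⟩ := hf N
    exact ⟨(k, a), fun h => hka h⟩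
  have hSdir : Directed (· ⊇ ·) S := by
    intro N₁ N₂
    refine ⟨N₁ ⊓ N₂, fun q hq h => ?_, fun q hq h => ?_⟩
    · exact (show (N₁ ⊓ N₂).toSubgroup ≤ N₁.toSubgroup from inf_le_left) (hq h)
    · exact (show (N₁ ⊓ N₂).toSubgroup ≤ N₂.toSubgroup from inf_le_right) (hq h)
  obtain ⟨q, hq⟩ := IsCompact.nonempty_iInter_of_directed_nonempty_isCompact_isClosed S hSdir hSne
    (fun N => (hScl N).isCompact) hScl
  -- the common point `q = (k, a)` works everywhere
  refine ⟨q.1, (mem_contCoboundaries_iff _).mpr ⟨q.2, funext fun h => ?_⟩⟩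
  have hall : ∀ N : OpenNormalSubgroup G', e h q ∈ N.toSubgroup := fun N => (Set.mem_iInter.mp hq N) h
  have h1 : e h q = 1 := eq_one_of_forall_mem_openNormal' _ hall
  have h2 : ((f h : A) : G') * (((u q.1 h : A) : G'))⁻¹ =
      (((MulAut.conjNormal (φ (h : G)) q.2 * q.2⁻¹ : A)) : G') := mul_inv_eq_one.mp h1
  apply Subtype.ext
  simp only [Pi.mul_apply, Pi.inv_apply, Subgroup.coe_mul, Subgroup.coe_inv] at h2 ⊢
  exact h2

/-- **A compactly parametrised family of classes is congruence-closed** — class level, in the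
representative-congruence currency of `ContH1Separated` (abc-iut-f-128): for a family of continuous cocycles
`u : K → contCocycles φ A H` with `K` COMPACT and `k ↦ (u k)(h)` continuous for each `h`, a class `x` such that for every
open normal `N ⊴ G′` SOME member `[u k_N]` has a representative congruent modulo `N` (pointwise) to a representative of
`x` IS a member: `x = [u k]` for some `k ∈ K`.  (The different `k_N` need not converge; compactness of `K × A` picks
the `k`.)  With `K = Unit`, `u = 1` this is `ContH1.mk_eq_one_of_forall_congr`.
[cite: NeukirchSchmidtWingberg2008, I §2 and II §7] [cite: MochizukiEtTh2009, Rmk 1.6.4 p.252] -/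
theorem exists_eq_mk_of_forall_exists_rep_congr_family [CompactSpace G'] [T2Space G']
    [TotallyDisconnectedSpace G'] (hA : IsClosed (A : Set G')) {K : Type*} [TopologicalSpace K] [CompactSpace K]
    (u : K → contCocycles φ A H) (hu : ∀ h : H, Continuous fun k : K => (((u k).1 h : A) : G'))
    (x : ContH1 φ A H)
    (hx : ∀ N : OpenNormalSubgroup G', ∃ k : K, ∃ f g : contCocycles φ A H,
      (QuotientGroup.mk f : ContH1 φ A H) = x ∧
        (QuotientGroup.mk g : ContH1 φ A H) = QuotientGroup.mk (u k) ∧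
          ∀ h : H, ((f.1 h : A) : G') * (((g.1 h : A) : G'))⁻¹ ∈ N.toSubgroup) :
    ∃ k : K, x = (QuotientGroup.mk (u k) : ContH1 φ A H) := by
  induction x using QuotientGroup.induction_on with
  | H f₀ =>
    -- representative level: `f₀ · (u k)⁻¹` is a coboundary for some `k`
    obtain ⟨k, hk⟩ := exists_mul_inv_mem_contCoboundaries_of_forall_congr_family (φ := φ) hA
      (fun k => (u k).1) hu f₀.1 (fun N => by
        obtain ⟨k, f, g, hf, hg, hcongr⟩ := hx N
        -- move the congruence of the representatives `f, g` to the fixed representatives `f₀, u k`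
        obtain ⟨b₁, hb₁⟩ := exists_coboundary_of_mk_eq'' f f₀ hf
        obtain ⟨b₂, hb₂⟩ := exists_coboundary_of_mk_eq'' g (u k) hg
        refine ⟨k, b₁ * b₂⁻¹, fun h => ?_⟩
        have key : f₀.1 h * ((u k).1 h)⁻¹ *
            (MulAut.conjNormal (φ (h : G)) (b₁ * b₂⁻¹) * (b₁ * b₂⁻¹)⁻¹)⁻¹ = f.1 h * (g.1 h)⁻¹ := by
          rw [hb₁ h, hb₂ h]
          apply Additive.ofMul.injective
          simp only [map_mul, map_inv, mul_inv_rev, inv_inv, ofMul_mul, ofMul_inv]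
          abel
        have key' := congrArg (fun a : A => (a : G')) key
        have hc := hcongr h
        simp only [Subgroup.coe_mul, Subgroup.coe_inv] at key' hc ⊢
        rw [key']
        exact hc)
    refine ⟨k, ?_⟩
    -- `f₀ (u k)⁻¹ ∈ ∂A` gives `[f₀] = [u k]`
    have hmem : (f₀ * (u k)⁻¹ : contCocycles φ A H) ∈
        (contCoboundaries φ A H).subgroupOf (contCocycles φ A H) := Subgroup.mem_subgroupOf.mpr hk
    have h1 : (QuotientGroup.mk (f₀ * (u k)⁻¹) : ContH1 φ A H) = 1 := (QuotientGroup.eq_one_iff _).mpr hmem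
    rw [QuotientGroup.mk_mul, QuotientGroup.mk_inv, mul_inv_eq_one] at h1
    exact h1

/-- The same, as a membership: `⋂_N (U · K_N) ⊆ U` for `U = {[u k] | k ∈ K}` the family's set of classes and `K_N` the
classes admitting a representative-congruence to `1` modulo `N` — a class congruent to the family modulo every open
normal subgroup lies IN the family. [cite: NeukirchSchmidtWingberg2008, I §2 and II §7] -/
theorem mem_range_of_forall_exists_rep_congr_family [CompactSpace G'] [T2Space G']
    [TotallyDisconnectedSpace G'] (hA : IsClosed (A : Set G')) {K : Type*} [TopologicalSpace K] [CompactSpace K]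
    (u : K → contCocycles φ A H) (hu : ∀ h : H, Continuous fun k : K => (((u k).1 h : A) : G'))
    (x : ContH1 φ A H)
    (hx : ∀ N : OpenNormalSubgroup G', ∃ k : K, ∃ f g : contCocycles φ A H,
      (QuotientGroup.mk f : ContH1 φ A H) = x ∧
        (QuotientGroup.mk g : ContH1 φ A H) = QuotientGroup.mk (u k) ∧
          ∀ h : H, ((f.1 h : A) : G') * (((g.1 h : A) : G'))⁻¹ ∈ N.toSubgroup) :
    x ∈ Set.range (fun k : K => (QuotientGroup.mk (u k) : ContH1 φ A H)) := by
  obtain ⟨k, hk⟩ := exists_eq_mk_of_forall_exists_rep_congr_family hA u hu x hx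
  exact ⟨k, hk.symm⟩

/-- The jointly continuous case: if `(k, h) ↦ (u k)(h)` is continuous on `K × H` (e.g. a continuous Kummer cocycle of a
compact group of units), the family `{[u k]}` is congruence-closed. [cite: NeukirchSchmidtWingberg2008, I §2 and II §7] -/
theorem exists_eq_mk_of_forall_exists_rep_congr_family₂ [CompactSpace G'] [T2Space G']
    [TotallyDisconnectedSpace G'] (hA : IsClosed (A : Set G')) {K : Type*} [TopologicalSpace K] [CompactSpace K]
    (u : K → contCocycles φ A H) (hu : Continuous fun q : K × H => (((u q.1).1 q.2 : A) : G'))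
    (x : ContH1 φ A H)
    (hx : ∀ N : OpenNormalSubgroup G', ∃ k : K, ∃ f g : contCocycles φ A H,
      (QuotientGroup.mk f : ContH1 φ A H) = x ∧
        (QuotientGroup.mk g : ContH1 φ A H) = QuotientGroup.mk (u k) ∧
          ∀ h : H, ((f.1 h : A) : G') * (((g.1 h : A) : G'))⁻¹ ∈ N.toSubgroup) :
    ∃ k : K, x = (QuotientGroup.mk (u k) : ContH1 φ A H) :=
  exists_eq_mk_of_forall_exists_rep_congr_family hA u
    (fun h => hu.comp (continuous_id.prodMk (continuous_const (y := h)))) x hx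

/-! ### §2. The range of a homomorphism from a COMPACT group whose small open subgroups are congruent to `1`
(no root systems; e.g. a Kummer map on a compact unit group `O^×` in which `n`-th powers contain an open subgroup) -/

omit [TopologicalSpace G] [TopologicalSpace G'] [IsTopologicalGroup G'] [A.Normal] [IsMulCommutative A] in
/-- A subset of a topological group saturated under right multiplication by an open subgroup is clopen. [folklore] -/
private theorem isClopen_of_mul_openSubgroup_subset {M : Type*} [Group M] [TopologicalSpace M] [ContinuousMul M]
    (W : OpenSubgroup M) (S : Set M) (hS : ∀ s ∈ S, ∀ w ∈ W, s * w ∈ S) : IsClopen S := by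
  -- both `S` and `Sᶜ` are unions of open cosets `s·W`
  have hopen : ∀ S' : Set M, (∀ s ∈ S', ∀ w ∈ W, s * w ∈ S') → IsOpen S' := by
    intro S' hS'
    have : S' = ⋃ s ∈ S', (fun w : M => s * w) '' (W : Set M) := by
      ext m
      simp only [Set.mem_iUnion, Set.mem_image, SetLike.mem_coe, exists_prop]
      constructor
      · intro hm
        exact ⟨m, hm, 1, W.one_mem, mul_one m⟩
      · rintro ⟨s, hs, w, hw, rfl⟩
        exact hS' s hs w hw
    rw [this]
    exact isOpen_biUnion fun s _ => (isOpenMap_mul_left s) _ W.isOpen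
  refine ⟨⟨hopen Sᶜ fun s hs w hw hsw => hs ?_⟩, hopen S hS⟩
  have := hS (s * w) hsw w⁻¹ (W.inv_mem hw)
  rwa [mul_inv_cancel_right] at this

/-- Representative-congruence modulo a subgroup is symmetric. [folklore] -/
private theorem exists_rep_congr_symm (N : Subgroup G') {x y : ContH1 φ A H}
    (hxy : ∃ f g : contCocycles φ A H, (QuotientGroup.mk f : ContH1 φ A H) = x ∧
      (QuotientGroup.mk g : ContH1 φ A H) = y ∧ ∀ h : H, ((f.1 h : A) : G') * (((g.1 h : A) : G'))⁻¹ ∈ N) :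
    ∃ f g : contCocycles φ A H, (QuotientGroup.mk f : ContH1 φ A H) = y ∧
      (QuotientGroup.mk g : ContH1 φ A H) = x ∧ ∀ h : H, ((f.1 h : A) : G') * (((g.1 h : A) : G'))⁻¹ ∈ N := by
  obtain ⟨f, g, hf, hg, hfg⟩ := hxy
  refine ⟨g, f, hg, hf, fun h => ?_⟩
  have := N.inv_mem (hfg h)
  rwa [mul_inv_rev, inv_inv] at this

/-- **The range of a homomorphism `κ : M → H¹` from a COMPACT group is congruence-closed, provided every open normal
`N ⊴ G′` admits an open subgroup `W ≤ M` with `κ(w) ≡ 1 (mod N)` for all `w ∈ W`** (representative-congruence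
currency of `ContH1Separated`).  Then a class `x` congruent modulo every `N` to SOME `κ(m_N)` equals some `κ(m)`.
Proof: the sets `T_N = {m | x ≡ κ(m) mod N}` are `W`-saturated (`exists_rep_congr_mul`), hence clopen, non-empty and
directed in the compact `M`; at a common point `m`, `x ≡ κ(m)` modulo every `N`, so `x = κ(m)` by
`eq_of_forall_exists_rep_congr` (abc-iut-f-128).  No topology on `H¹` and no continuity of `κ` is used.
[cite: NeukirchSchmidtWingberg2008, I §2 and II §7] [cite: MochizukiEtTh2009, Rmk 1.6.4 p.252] -/
theorem exists_eq_of_forall_exists_rep_congr_range [CompactSpace G'] [T2Space G'] [TotallyDisconnectedSpace G']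
    (hA : IsClosed (A : Set G')) {M : Type*} [Group M] [TopologicalSpace M] [ContinuousMul M] [CompactSpace M]
    (κ : M →* ContH1 φ A H)
    (hκ : ∀ N : OpenNormalSubgroup G', ∃ W : OpenSubgroup M, ∀ w ∈ W, ∃ f g : contCocycles φ A H,
      (QuotientGroup.mk f : ContH1 φ A H) = κ w ∧ (QuotientGroup.mk g : ContH1 φ A H) = 1 ∧
        ∀ h : H, ((f.1 h : A) : G') * (((g.1 h : A) : G'))⁻¹ ∈ N.toSubgroup)
    (x : ContH1 φ A H)
    (hx : ∀ N : OpenNormalSubgroup G', ∃ m : M, ∃ f g : contCocycles φ A H,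
      (QuotientGroup.mk f : ContH1 φ A H) = x ∧ (QuotientGroup.mk g : ContH1 φ A H) = κ m ∧
        ∀ h : H, ((f.1 h : A) : G') * (((g.1 h : A) : G'))⁻¹ ∈ N.toSubgroup) :
    ∃ m : M, x = κ m := by
  classical
  haveI : Nonempty (OpenNormalSubgroup G') :=
    ⟨{ toOpenSubgroup := ⊤, isNormal' := by
        rw [OpenSubgroup.toSubgroup_top]
        infer_instance }⟩
  -- `T_N = {m | x ≡ κ(m) (mod N)}`
  let T : OpenNormalSubgroup G' → Set M := fun N => {m : M | ∃ f g : contCocycles φ A H,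
      (QuotientGroup.mk f : ContH1 φ A H) = x ∧ (QuotientGroup.mk g : ContH1 φ A H) = κ m ∧
        ∀ h : H, ((f.1 h : A) : G') * (((g.1 h : A) : G'))⁻¹ ∈ N.toSubgroup}
  -- saturation under `W_N`, whence clopen
  have hTcl : ∀ N, IsClosed (T N) := by
    intro N
    obtain ⟨W, hW⟩ := hκ N
    refine (isClopen_of_mul_openSubgroup_subset W (T N) fun m hm w hw => ?_).isClosed
    -- `x · 1 ≡ κ m · κ w (mod N)`
    obtain ⟨f, g, hf, hg, hfg⟩ := hm
    have hmul := exists_rep_congr_mul (x₁ := x) (y₁ := κ m) (x₂ := (1 : ContH1 φ A H)) (y₂ := κ w)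
      N.toSubgroup ⟨f, g, hf, hg, hfg⟩ (exists_rep_congr_symm N.toSubgroup (hW w hw))
    rw [mul_one, ← map_mul] at hmul
    exact hmul
  have hTne : ∀ N, (T N).Nonempty := fun N => hx N
  have hTdir : Directed (· ⊇ ·) T := by
    intro N₁ N₂
    refine ⟨N₁ ⊓ N₂, fun m hm => ?_, fun m hm => ?_⟩
    · obtain ⟨f, g, hf, hg, hfg⟩ := hm
      exact ⟨f, g, hf, hg, fun h => (show (N₁ ⊓ N₂).toSubgroup ≤ N₁.toSubgroup from inf_le_left) (hfg h)⟩
    · obtain ⟨f, g, hf, hg, hfg⟩ := hm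
      exact ⟨f, g, hf, hg, fun h => (show (N₁ ⊓ N₂).toSubgroup ≤ N₂.toSubgroup from inf_le_right) (hfg h)⟩
  obtain ⟨m, hm⟩ := IsCompact.nonempty_iInter_of_directed_nonempty_isCompact_isClosed T hTdir hTne
    (fun N => (hTcl N).isCompact) hTcl
  exact ⟨m, eq_of_forall_exists_rep_congr hA x (κ m) fun N => Set.mem_iInter.mp hm N⟩

omit [A.Normal] [IsMulCommutative A] in
/-- For an open normal `N ⊴ G′` of the compact `G′`: some positive power of every element of the closed `A` lies in
`N` (a private copy of abc-iut-f-128's `exists_pow_mem`). [folklore] -/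
private theorem exists_pow_mem' [CompactSpace G'] (hA : IsClosed (A : Set G')) (N : OpenNormalSubgroup G') :
    ∃ n : ℕ, 0 < n ∧ ∀ a : A, ((a : G')) ^ n ∈ N.toSubgroup := by
  haveI : CompactSpace A := isCompact_iff_compactSpace.mp hA.isCompact
  let M : Subgroup A := N.toSubgroup.comap A.subtype
  have hMo : IsOpen (M : Set A) := N.toOpenSubgroup.isOpen.preimage continuous_subtype_val
  haveI : Finite (A ⧸ M) := Subgroup.quotient_finite_of_isOpen M hMo
  haveI : M.FiniteIndex := Subgroup.finiteIndex_of_finite_quotient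
  refine ⟨M.index, Nat.pos_of_ne_zero Subgroup.FiniteIndex.index_ne_zero, fun a => ?_⟩
  have h := M.pow_index_mem a
  rw [Subgroup.mem_comap, map_pow] at h
  exact h

/-- **Powers version** — the shape of a compact unit group: if for every `n ≥ 1` the `n`-th powers of `M` contain an
open subgroup (e.g. `O^×_K` of a `p`-adic field: `1 + 𝔪^k ⊆ (O^×)ⁿ` for `k ≫ 0`), then the range of ANY homomorphism
`κ : M → H¹` (profinite ambient coefficients, `A` closed) is congruence-closed: a class congruent modulo every open
normal `N` to some `κ(m_N)` IS some `κ(m)`.  (`κ(vⁿ) = κ(v)ⁿ` is represented by `gⁿ ≡ 1 (mod N)` once `Aⁿ ⊆ N`.)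
[cite: NeukirchSchmidtWingberg2008, I §2 and II §7] [cite: MochizukiEtTh2009, Rmk 1.6.4 p.252] -/
theorem exists_eq_of_forall_exists_rep_congr_range_of_pow [CompactSpace G'] [T2Space G']
    [TotallyDisconnectedSpace G'] (hA : IsClosed (A : Set G')) {M : Type*} [Group M] [TopologicalSpace M]
    [ContinuousMul M] [CompactSpace M] (κ : M →* ContH1 φ A H)
    (hdiv : ∀ n : ℕ, 0 < n → ∃ W : OpenSubgroup M, ∀ w ∈ W, ∃ v : M, v ^ n = w)
    (x : ContH1 φ A H)
    (hx : ∀ N : OpenNormalSubgroup G', ∃ m : M, ∃ f g : contCocycles φ A H,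
      (QuotientGroup.mk f : ContH1 φ A H) = x ∧ (QuotientGroup.mk g : ContH1 φ A H) = κ m ∧
        ∀ h : H, ((f.1 h : A) : G') * (((g.1 h : A) : G'))⁻¹ ∈ N.toSubgroup) :
    ∃ m : M, x = κ m := by
  refine exists_eq_of_forall_exists_rep_congr_range hA κ (fun N => ?_) x hx
  obtain ⟨n, hn, hpow⟩ := exists_pow_mem' (A := A) hA N
  obtain ⟨W, hW⟩ := hdiv n hn
  refine ⟨W, fun w hw => ?_⟩
  obtain ⟨v, rfl⟩ := hW w hw
  -- a representative `g` of `κ v`; then `gⁿ` represents `κ (vⁿ) = (κ v)ⁿ` and `gⁿ(h) = g(h)ⁿ ∈ N`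
  induction hκv : κ v using QuotientGroup.induction_on with
  | H g =>
    refine ⟨g ^ n, 1, ?_, ?_, fun h => ?_⟩
    · rw [map_pow, hκv]
      exact QuotientGroup.mk_pow _ g n
    · exact QuotientGroup.mk_one _
    · have hval : (((g ^ n : contCocycles φ A H) : H → A) h) = (g.1 h) ^ n := by
        simp only [Subgroup.coe_pow, Pi.pow_apply]
      have h1 : (((1 : contCocycles φ A H) : H → A) h) = 1 := rfl
      change ((((g ^ n : contCocycles φ A H) : H → A) h : A) : G') *
        (((((1 : contCocycles φ A H) : H → A) h : A) : G'))⁻¹ ∈ N.toSubgroup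
      rw [hval, h1, Subgroup.coe_one, inv_one, mul_one, Subgroup.coe_pow]
      exact hpow (g.1 h)

end ContH1

end Literature.AnabelianGeometry.EtaleTheta

end
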